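import Literature.MathematicalPhysics.QuantumFieldTheory.Balaban1983to89.B16StepFactorsPrinted
import Summits.QuantumFields.BalabanUV.T4Continuum.Spine.NE7c.LiveFactorLargeField

/-!
# `T4Continuum.Spine.NE7c.LiveFactorStepFactors` — spine estimate NE7c (node U5b), road (δ) THRESHOLD RANDOMISATION:
# the (L1-step) robustness of the LARGE-FIELD FACTOR BLOCK written in the currency the NE7b lineage instantiates —
# the per-step printed claim `Lit.B16StepFactorsPrinted` ([B16] pp. 380–383, p344269) — and the discharge of its two
# «g small» rounding hypotheses at the live letters by print's provisos (cell `pub-balaban-gaps`, track G2, seat ne8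
# gen 5; record `HOME/ne/NE7c.md` §12)

HONEST FRAMING.  Finite four-torus programme, rung (B)+1 only — NOT infinite volume, NOT a mass gap, NOT the Clay
problem, NOT summit progress, NOT a proof of NE7c (`T4IndicatorShell.ShellWeightBound`, INSTANCE 0∕1, which waits on
node O) and NOT a proof of NE7b.  Nothing of [Bałaban 1983–89] is asserted beyond print: `StepDisplaysAt` ∕
`StepFactorsPrinted` are HYPOTHESIS SHAPES of the tree (pp. 380–383's sentences over abstract one-step carriers), the
live sentences below are shapes of the same kind, and what is PROVED is monotonicity of `exp` plus real arithmetic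
already landed in the companion `…Spine.NE7c.LiveFactorLargeField` (p340750).  This file does NOT verify that the
large-field factor block is the only place a live threshold enters a step (census completeness is NOT PRINTED, GAPS
G-ne7cp1-2; the cell's two-reader census is `HOME/ne/NE7c.md` §7∕§9–§11).  Spine PROVED 0∕9 — unchanged.

WHY THIS LEAF.  Road (δ) (member (δ-1) of `Lit.T4ShellMeasure` §8e; socket `Lit.T4ShellMeasureSocket.
hybridNE7_tail_of_liveFactor`, whose `∀ c`-binders ARE (L1-step)) lowers every LIVE small-field threshold of one run by
a common factor `λ ∈ [λ₀, 1]`; per threshold this is `(A₀, A₁) ↦ (μA₀, μA₁)`, `μ ∈ [λ₀, 1]`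
(`LiveFactorLargeField.live_dictionary`).  The NE7b lineage has since landed the currency in which node O's step
junction will cite print: `Lit.B16StepFactorsPrinted.StepDisplaysAt D j X c` — pp. 380–383's factor sentences
(Y) (V) (F) (P) (I) for ONE step on abstract carriers `X` with letters `c : Consts` — with its PROVED junction
`stepFactor179_le` to (1.79)'s per-step factor, modulo two displayed «g small» hypotheses `hsmall` (p. 381
`4 ≦ γ₀A₁²p₀(g_{j+1})`) and `hround` (p. 383 «we estimate the factors by exp(−p₀(g_j))»).  (L1-step) for this block is
then ONE question: do the LIVE sentences — (F) with the created level's thresholds scaled by `μ ≥ λ₀` (print's left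
member `exp(−γ₀ min{½B₃⁻²(μA₀)², 2(μA₁)², (μA₁)²}p₀²(g_{j+1})(d′ + 1))`), (P) with the selected bond's threshold
`μ′·p₁(g_j)`, `μ′ ≥ λ₀` (kept form `exp(−R_j^{−d−5}(μ′p₁(g_j))²)`, companion `lfFactor178_live`), (Y) (V) (I) unchanged
(the C8 shift of p. 380's «O(1) log g_j⁻²|Z_j|» lives in the LETTER `C380`) — inhabit the SAME structure?  YES, with
the live letters `γ₀ ↦ λ₀²γ₀`, `p₁(·) ↦ λ₀·p₁(·)` and nothing else moved (§2); and `stepFactor179_le`'s two rounding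
hypotheses AT THOSE LETTERS are print's p. 381 clause with `A₁ ↦ λ₀A₁` and p. 383's margin read with the live factor —
both discharged below ONE `g⋆(λ₀; A₀, A₁, γ₀, L, r₀, p₀, p₁, d)` by the companions (§4).  So when (A1c)∕J4 instantiate
`StepFactorsPrinted` for Bałaban's tower, the lowered-threshold run is served by THIS file (no per-level amplitude
parameters needed; gen-4 interface note [GAPSNE8-G4-LANDED] superseded).  ON THE LETTER THAT CARRIES `λ₀²`: `exp` is
blind to where the factor sits in `γ₀·min{…}·p₀²`; every downstream consumer sees `γ₀A₁²` only ((1.79)∕(1.80)∕(1.85),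
`display381`, `birthRoom381`), so `γ₀ ↦ λ₀²γ₀` and the companions' `A₁ ↦ λ₀A₁` agree there (§3 states the conclusion
in the companions' form); charging `γ₀` needs NO ledger relation and leaves the profile's own `A₀` in
`Lit.p0Profile A₀ p₀` untouched (the shape's (F) carries `A₀` twice — chair note N-1 on p344269).

WHAT IS HERE (all PROVED, [folklore]; `Lit.` = `Literature.MathematicalPhysics.QuantumFieldTheory.Balaban1983to89`).
* §1 `minConst_nonneg`, `minConst_live` (`min{…}` at `(μA₀, μA₁)` is `μ²·min{…}`), `minConst_live_le` (stage-wise factors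
  `μ₀ ≠ μ₁` on `ε`, `δ`: the minimum at `(μ₀A₀, μ₁A₁)` dominates `μ²·min{…}`, `μ = min`), `exp_live_le` (monotonicity), and
  `componentFactor_le_live`: the live (F) sentence IS what pp. 380–381's three factors yield at lowered thresholds
  (`Lit.B16LargeFieldFactors380.componentFactor_le` in the live dictionary); `volumeLine380_absorbs_shift`: the C8
  shift of the created region's normalisation cost is absorbed by the LETTER `C380` of (V) once `log g⁻² ≧ 1`.
* §2 `stepDisplaysAt_live`: the live sentences with per-component factors `μ ≥ λ₀ ≥ 0` ⇒
  `StepDisplaysAt D j X {c with γ₀ := λ₀²γ₀, P1 := λ₀·P1}`; `liveLetters_one`: at `λ₀ = 1` the letters are `c`.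
* §3 `stepFactor179_le_live`: live sentences + `stepFactor179_le`'s inputs with `hsmall`, `hround` AT THE LIVE LETTERS
  ⇒ (1.79)'s per-step factor with `A₁² ↦ (λ₀A₁)²` and print's `−2p₀(g_{j+1})`, `exp(−p₀(g_j))` VERBATIM.
* §4 `liveRounding_of_g_small`: the two live-letter hypotheses from print's provisos below ONE `g⋆` (companions'
  `clause_of_g_small` + `liveFactor383_of_g_small` at `μ = λ₀`); HEADLINE `stepFactor179_live_of_g_small`: closed form —
  letters by (2.4)∕(2.5) [III] and the STRICT proviso of p. 383 fixed, THEN `∃ g⋆ > 0`, THEN for every run, step with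
  `0 < g_j, g_{j+1} ≦ g⋆`, carriers and live factors `≥ λ₀`: live sentences ⇒ (1.79)'s per-step factor at `(λ₀A₁)²`.
* §5 `stepFactorsPrinted_live`: the printed-claim pattern — a construction whose runs satisfy the LIVE sentences at
  every step in the window `]0, γ]` satisfies `StepFactorsPrinted C X {c with γ₀ := λ₀²γ₀, P1 := λ₀·P1}`.
* §6 sanity (shape non-vacuity; honest scope).
NOT HERE: node O ∕ (A1c) (which carriers are Bałaban's), U1b's two-run rate, (W1), the C8∕C5′ leaves (companions), the
history regrouping J4; no `def … : Prop` hypothesis is minted; 0 sorry.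
-/

namespace Summit.QuantumFields.BalabanUV.T4Continuum.Spine.NE7c.LiveFactorStepFactors

open Literature.MathematicalPhysics.QuantumFieldTheory.Balaban1983to89
open B16LargeFieldFactors380 B16StepFactorsPrinted B16Sect1Kernels
open Summit.QuantumFields.BalabanUV.T4Continuum.Spine.NE7c.LiveFactorLargeField

noncomputable section

/-! ## §1. The printed minimum under the live substitution; monotonicity -/

/-- The printed minimum `min{½B₃⁻²A₀², 2A₁², A₁²}` of [B16] p. 381 (`Lit.B16LargeFieldFactors380.minConst`) is
non-negative. [folklore] -/
theorem minConst_nonneg (B₃ A₀ A₁ : ℝ) : 0 ≤ minConst B₃ A₀ A₁ := by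
  unfold minConst
  have : 0 ≤ (B₃ ^ 2)⁻¹ := inv_nonneg.mpr (sq_nonneg _)
  exact le_min (le_min (by positivity) (by positivity)) (sq_nonneg _)

/-- Road (δ)'s live substitution `(A₀, A₁) ↦ (μA₀, μA₁)` (one factor `μ` on both thresholds `ε_j`, `δ_j` of the level,
`LiveFactorLargeField.live_dictionary`) multiplies the printed minimum by `μ²`:
`min{½B₃⁻²(μA₀)², 2(μA₁)², (μA₁)²} = μ²·min{½B₃⁻²A₀², 2A₁², A₁²}`. [folklore] -/
theorem minConst_live (B₃ A₀ A₁ μ : ℝ) : minConst B₃ (μ * A₀) (μ * A₁) = μ ^ 2 * minConst B₃ A₀ A₁ := by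
  have hμ : 0 ≤ μ ^ 2 := sq_nonneg μ
  unfold minConst
  rw [show 1 / 2 * (B₃ ^ 2)⁻¹ * (μ * A₀) ^ 2 = μ ^ 2 * (1 / 2 * (B₃ ^ 2)⁻¹ * A₀ ^ 2) by ring,
    show 2 * (μ * A₁) ^ 2 = μ ^ 2 * (2 * A₁ ^ 2) by ring, show (μ * A₁) ^ 2 = μ ^ 2 * A₁ ^ 2 by ring,
    ← mul_min_of_nonneg _ _ hμ, ← mul_min_of_nonneg _ _ hμ]

/-- … and if the two thresholds of the level carry DIFFERENT factors `μ₀` (on `ε`, amplitude `A₀`) and `μ₁` (on `δ`,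
amplitude `A₁`) — the stage-wise member (δ-stages) of `Lit.T4ShellMeasure` §8, whose factors are not common to all
kinds — the printed minimum at `(μ₀A₀, μ₁A₁)` still dominates `μ²·min{…}` for any `0 ≤ μ ≤ min{μ₀, μ₁}`: §2's
(F)-hypothesis with the single factor `μ` is implied (each entry of the minimum is monotone in its amplitude squared).
[folklore] -/
theorem minConst_live_le {B₃ A₀ A₁ μ μ₀ μ₁ : ℝ} (hμ : 0 ≤ μ) (h₀ : μ ≤ μ₀) (h₁ : μ ≤ μ₁) :
    μ ^ 2 * minConst B₃ A₀ A₁ ≤ minConst B₃ (μ₀ * A₀) (μ₁ * A₁) := by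
  rw [← minConst_live]
  have hB : 0 ≤ 1 / 2 * (B₃ ^ 2)⁻¹ := by have := inv_nonneg.mpr (sq_nonneg B₃); positivity
  have e₀ : (μ * A₀) ^ 2 ≤ (μ₀ * A₀) ^ 2 := by
    rw [mul_pow, mul_pow]; exact mul_le_mul_of_nonneg_right (pow_le_pow_left₀ hμ h₀ 2) (sq_nonneg _)
  have e₁ : (μ * A₁) ^ 2 ≤ (μ₁ * A₁) ^ 2 := by
    rw [mul_pow, mul_pow]; exact mul_le_mul_of_nonneg_right (pow_le_pow_left₀ hμ h₁ 2) (sq_nonneg _)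
  exact min_le_min (min_le_min (mul_le_mul_of_nonneg_left e₀ hB) (by linarith)) e₁

/-- Monotonicity: a factor `exp(−μ²E)` with `E ≥ 0` and `μ ≥ λ₀ ≥ 0` is at most `exp(−λ₀²E)`. [folklore] -/
theorem exp_live_le {E lam₀ μ : ℝ} (hE : 0 ≤ E) (h0 : 0 ≤ lam₀) (hμ : lam₀ ≤ μ) :
    Real.exp (-(μ ^ 2 * E)) ≤ Real.exp (-(lam₀ ^ 2 * E)) :=
  Real.exp_le_exp.mpr (neg_le_neg (mul_le_mul_of_nonneg_right (pow_le_pow_left₀ h0 hμ 2) hE))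

/-- **THE C8 SHIFT LIVES IN THE LETTER `C380`.**  Under road (δ) the threshold-RESTRICTED normalisations of a created
region cost an extra `S·|Z|`, `S = k·log λ₀⁻¹ ≥ 0` per site (census class C8; companion
`LiveFactorRestrictedGaussian.restrictedGaussian_lower_live`, Jacobian form); in p. 380's FIRST printed form
«O(1) log g_j⁻²|Z_j|» this is absorbed by the letter: `(C380·log g⁻² + S)·|Z| ≦ (C380 + S)·log g⁻²·|Z|` as soon as
`log g⁻² ≧ 1` (i.e. `g ≦ e^{−1∕2}`, a `λ₀`-free smallness) — so the live (V) sentence is print's (V) with the letter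
`C380 + S`, which is why §2 keeps (V) in print's shape with an arbitrary real `C380`. [folklore] -/
theorem volumeLine380_absorbs_shift {C380 S ℓ volZ v : ℝ} (hS : 0 ≤ S) (hℓ : 1 ≤ ℓ) (hvol : 0 ≤ volZ)
    (hv : v ≤ Real.exp ((C380 * ℓ + S) * volZ)) : v ≤ Real.exp ((C380 + S) * ℓ * volZ) := by
  refine hv.trans (Real.exp_le_exp.mpr ?_)
  have := mul_le_mul_of_nonneg_left hℓ (mul_nonneg hS hvol)
  nlinarith

/-- **WHERE THE LIVE (F) SENTENCE COMES FROM** — [B16] pp. 380–381 with the created level's two thresholds lowered by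
one factor `μ` (`ε ↦ με`, `δ ↦ μδ`, road (δ) at a live level; `μ = 1` at a dead one): the tree's per-component
combination `Lit.B16LargeFieldFactors380.componentFactor_le` (the three printed factors `exp(−expP)·exp(−expQ)·exp(−expR)`
⇒ print's LEFT member `exp(−γ₀ min{…}p₀²(g)(d′ + 1))`) applies VERBATIM in the dictionary `με = g·(μA₀)·p₀(g)`,
`μδ = g·(μA₁)·p₀(g)` (`LiveFactorLargeField.live_dictionary`) and yields the left member at the scaled amplitudes
`(μA₀, μA₁)` — the (F)-hypothesis of §2, with the profile `p₀(g)` UNTOUCHED.  Inputs exactly print's (signs of the cube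
counts, the count `d′ + 1 ≦ nP + nQ + nR`). [folklore] -/
theorem componentFactor_le_live {γ₀ gj B₃ εj δj LM2R volP volQ volR A₀ A₁ p₀g d' μ : ℝ} {d : ℕ} (hgj : gj ≠ 0)
    (hγ : 0 ≤ γ₀) (hε : εj = gj * A₀ * p₀g) (hδ : δj = gj * A₁ * p₀g)
    (hP : 0 ≤ (LM2R ^ d)⁻¹ * volP) (hQ : 0 ≤ (LM2R ^ 2)⁻¹ * volQ) (hR : 0 ≤ (LM2R ^ d)⁻¹ * volR)
    (hcount : d' + 1 ≤ (LM2R ^ d)⁻¹ * volP + (LM2R ^ 2)⁻¹ * volQ + (LM2R ^ d)⁻¹ * volR) :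
    Real.exp (-expP γ₀ gj B₃ (μ * εj) LM2R d volP) * Real.exp (-expQ γ₀ gj (μ * δj) LM2R volQ) *
        Real.exp (-expR γ₀ gj (μ * δj) LM2R d volR) ≤
      Real.exp (-(γ₀ * minConst B₃ (μ * A₀) (μ * A₁) * p₀g ^ 2 * (d' + 1))) :=
  componentFactor_le hgj hγ (by rw [hε]; ring) (by rw [hδ]; ring) hP hQ hR hcount

/-! ## §2. The live sentences inhabit `StepDisplaysAt` with the live letters -/

section Live

variable {D : B16.RunData} {j : ℕ} {X : StepCarriers D j} {c : B16StepFactorsPrinted.Consts} {lam₀ : ℝ}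

/-- **ROAD (δ)'s LIVE STEP SENTENCES INHABIT THE PRINTED PER-STEP CLAIM WITH LIVE LETTERS.**  Hypotheses = the five
conjuncts of `Lit.B16StepFactorsPrinted.StepDisplaysAt` for the step `j → j+1` of the run `D` on the carriers `X`, read
at LOWERED LIVE THRESHOLDS: (Y), (V) (letter `C380`: under road (δ) print's «O(1)» carries the C8 shift,
`volumeLine380_absorbs_shift`), (I) unchanged; (F) per created component in print's SHARP left form at the scaled
amplitudes `(μA₀, μA₁)`, `μ = μF p i ≥ λ₀` (`componentFactor_le_live`; `μ = 1` at a dead level); (P) per renewed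
component in the kept form with the selected bond's threshold `μ′·p₁(g_j)`, `μ′ = μP p i ≥ λ₀` (companion
`lfFactor178_live`).  Conclusion: `StepDisplaysAt D j X {c with γ₀ := λ₀²γ₀, P1 := λ₀·P1}` — the structure the NE7b
lineage's consumers cite, verbatim.  Signs used: `0 ≤ λ₀`, `0 ≤ γ₀`, `0 ≤ R(g_j)` (print: `γ₀ = ½`, `R_j = L^s`).  An
implication between hypothesis shapes; nothing of Bałaban's asserted. [folklore] -/
theorem stepDisplaysAt_live (h0 : 0 ≤ lam₀) (hγ : 0 ≤ c.γ₀) (hR : 0 ≤ c.R (D.flow.g j))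
    (μF μP : X.Choice → X.ι → ℝ) (hμF : ∀ p, ∀ i ∈ X.comps p, lam₀ ≤ μF p i)
    (hμP : ∀ p, ∀ i ∈ X.primed p, lam₀ ≤ μP p i)
    (hY : ∀ p v, X.T1 p v ≤
      X.gInt p * X.aInt p * X.vfac p * (∏ i ∈ X.comps p, X.bfac p i) * ∏ i ∈ X.primed p, X.lfPrep p i)
    (hV : ∀ p, 0 ≤ X.volZ p ∧ X.vfac p ≤ Real.exp (c.C380 * Real.log ((D.flow.g (j + 1)) ^ 2)⁻¹ * X.volZ p))
    (hF : ∀ p, ∀ i ∈ X.comps p, 0 ≤ X.dC p i ∧ 0 ≤ X.bfac p i ∧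
      X.bfac p i ≤ Real.exp (-(c.γ₀ * minConst c.B₃ (μF p i * c.A₀) (μF p i * c.A₁) *
        p0Profile c.A₀ c.p₀ (D.flow.g (j + 1)) ^ 2 * (X.dC p i + 1))))
    (hP : ∀ p, ∀ i ∈ X.primed p, 0 ≤ X.lfPrep p i ∧
      X.lfPrep p i ≤ Real.exp (-(c.R (D.flow.g j) ^ (c.d + 5))⁻¹ * (μP p i * c.P1 (D.flow.g j)) ^ 2))
    (hI : ∀ p, 0 ≤ X.gInt p ∧ X.gInt p ≤ 1 ∧ 0 ≤ X.aInt p ∧ X.aInt p ≤ Real.exp (c.C' * X.volZΩ p)) :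
    StepDisplaysAt D j X { c with γ₀ := lam₀ ^ 2 * c.γ₀, P1 := fun g => lam₀ * c.P1 g } := by
  refine ⟨hY, hV, fun p i hi => ?_, fun p i hi => ?_, hI⟩
  · obtain ⟨hd, hb, hle⟩ := hF p i hi -- (F): `exp(−γ₀μ²min{…}P²(d′+1)) ≤ exp(−λ₀²γ₀min{…}P²(d′+1))`
    refine ⟨hd, hb, hle.trans ?_⟩
    have hE : 0 ≤ c.γ₀ * minConst c.B₃ c.A₀ c.A₁ * p0Profile c.A₀ c.p₀ (D.flow.g (j + 1)) ^ 2 * (X.dC p i + 1) := by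
      have := minConst_nonneg c.B₃ c.A₀ c.A₁
      positivity
    have h := exp_live_le hE h0 (hμF p i hi)
    have e1 : c.γ₀ * minConst c.B₃ (μF p i * c.A₀) (μF p i * c.A₁) * p0Profile c.A₀ c.p₀ (D.flow.g (j + 1)) ^ 2 *
        (X.dC p i + 1) = μF p i ^ 2 * (c.γ₀ * minConst c.B₃ c.A₀ c.A₁ * p0Profile c.A₀ c.p₀ (D.flow.g (j + 1)) ^ 2 *
        (X.dC p i + 1)) := by
      rw [minConst_live]; ring
    show Real.exp _ ≤ Real.exp (-(lam₀ ^ 2 * c.γ₀ * minConst c.B₃ c.A₀ c.A₁ *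
      p0Profile c.A₀ c.p₀ (D.flow.g (j + 1)) ^ 2 * (X.dC p i + 1)))
    rw [e1]
    refine h.trans (le_of_eq ?_)
    congr 1
    ring
  · obtain ⟨hl, hle⟩ := hP p i hi -- (P) reads `(−(R^{d+5})⁻¹)·(μ′P1)²`: antitone in the square since `R ≥ 0`
    refine ⟨hl, hle.trans ?_⟩
    show Real.exp (-(c.R (D.flow.g j) ^ (c.d + 5))⁻¹ * (μP p i * c.P1 (D.flow.g j)) ^ 2) ≤
      Real.exp (-(c.R (D.flow.g j) ^ (c.d + 5))⁻¹ * (lam₀ * c.P1 (D.flow.g j)) ^ 2)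
    have hinv : 0 ≤ (c.R (D.flow.g j) ^ (c.d + 5))⁻¹ := inv_nonneg.mpr (pow_nonneg hR _)
    have hsq : (lam₀ * c.P1 (D.flow.g j)) ^ 2 ≤ (μP p i * c.P1 (D.flow.g j)) ^ 2 := by
      rw [mul_pow, mul_pow]
      exact mul_le_mul_of_nonneg_right (pow_le_pow_left₀ h0 (hμP p i hi) 2) (sq_nonneg _)
    exact Real.exp_le_exp.mpr (mul_le_mul_of_nonpos_left hsq (neg_nonpos.mpr hinv))

/-- At the slack `λ₀ = 1` (no lowering) the live letters ARE print's letters: the reading is conservative. [folklore] -/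
theorem liveLetters_one (c : B16StepFactorsPrinted.Consts) :
    { c with γ₀ := (1 : ℝ) ^ 2 * c.γ₀, P1 := fun g => 1 * c.P1 g } = c := by cases c; simp

end Live

/-! ## §3. (1.79)'s per-step factor from the live sentences, at the amplitude `λ₀A₁` -/

section Factor

variable {D : B16.RunData} {j : ℕ} {X : StepCarriers D j} {c : B16StepFactorsPrinted.Consts} {lam₀ : ℝ}

/-- **THE JUNCTION WITH (1.79)'s PER-STEP FACTOR, LIVE** (= `Lit.B16StepFactorsPrinted.stepFactor179_le` at the live
letters of §2).  Under the live step sentences and `stepFactor179_le`'s inputs — p. 380's chain `hchain`, `B₃ ≠ 0`,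
`0 ≦ p₀(g_{j+1})`, the HOMOGENEOUS ledger relation `2B₃²A₁² ≦ A₀²` (unchanged: census class C4) — with its two «g small»
hypotheses asked AT THE LIVE LETTERS, `hsmall : 4 ≦ γ₀(λ₀A₁)²p₀(g_{j+1})` (p. 381; companion `fundamentalFactor_le_live`)
and `hround : exp(−R_j^{−d−5}(λ₀p₁(g_j))²) ≦ exp(−p₀(g_j))` (p. 383 read with the live factor; companion
`liveFactor383_of_g_small`), the unit weight of the choice is at most
`gInt · aInt · exp(cV·M^d·R_{j+1}^{d+1}·dZ) · Π_i exp(−½γ₀(λ₀A₁)²p₀²(g_{j+1})(d′ + 1) − 2p₀(g_{j+1})) · Π′ exp(−p₀(g_j))` —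
(1.79)'s slots with `A₁ ↦ λ₀A₁` in the Gaussian amplitude and print's `−2p₀(g_{j+1})`, `exp(−p₀(g_j))` VERBATIM (the
companions' reading, in the NE7b lineage's currency).  Nothing of Bałaban's asserted. [folklore] -/
theorem stepFactor179_le_live (h0 : 0 ≤ lam₀) (hγ : 0 ≤ c.γ₀) (hR : 0 ≤ c.R (D.flow.g j))
    (μF μP : X.Choice → X.ι → ℝ) (hμF : ∀ p, ∀ i ∈ X.comps p, lam₀ ≤ μF p i)
    (hμP : ∀ p, ∀ i ∈ X.primed p, lam₀ ≤ μP p i)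
    (hY : ∀ p v, X.T1 p v ≤
      X.gInt p * X.aInt p * X.vfac p * (∏ i ∈ X.comps p, X.bfac p i) * ∏ i ∈ X.primed p, X.lfPrep p i)
    (hV : ∀ p, 0 ≤ X.volZ p ∧ X.vfac p ≤ Real.exp (c.C380 * Real.log ((D.flow.g (j + 1)) ^ 2)⁻¹ * X.volZ p))
    (hF : ∀ p, ∀ i ∈ X.comps p, 0 ≤ X.dC p i ∧ 0 ≤ X.bfac p i ∧
      X.bfac p i ≤ Real.exp (-(c.γ₀ * minConst c.B₃ (μF p i * c.A₀) (μF p i * c.A₁) *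
        p0Profile c.A₀ c.p₀ (D.flow.g (j + 1)) ^ 2 * (X.dC p i + 1))))
    (hP : ∀ p, ∀ i ∈ X.primed p, 0 ≤ X.lfPrep p i ∧
      X.lfPrep p i ≤ Real.exp (-(c.R (D.flow.g j) ^ (c.d + 5))⁻¹ * (μP p i * c.P1 (D.flow.g j)) ^ 2))
    (hI : ∀ p, 0 ≤ X.gInt p ∧ X.gInt p ≤ 1 ∧ 0 ≤ X.aInt p ∧ X.aInt p ≤ Real.exp (c.C' * X.volZΩ p))
    {cV : ℝ} (p : X.Choice)
    (hchain : c.C380 * Real.log ((D.flow.g (j + 1)) ^ 2)⁻¹ * X.volZ p ≤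
      cV * c.M ^ c.d * c.R (D.flow.g (j + 1)) ^ (c.d + 1) * X.dZ p)
    (hB₃ : c.B₃ ≠ 0) (hp : 0 ≤ p0Profile c.A₀ c.p₀ (D.flow.g (j + 1))) (hR2 : 2 * c.B₃ ^ 2 * c.A₁ ^ 2 ≤ c.A₀ ^ 2)
    (hsmall : 4 ≤ c.γ₀ * (lam₀ * c.A₁) ^ 2 * p0Profile c.A₀ c.p₀ (D.flow.g (j + 1)))
    (hround : Real.exp (-(c.R (D.flow.g j) ^ (c.d + 5))⁻¹ * (lam₀ * c.P1 (D.flow.g j)) ^ 2) ≤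
      Real.exp (-p0Profile c.A₀ c.p₀ (D.flow.g j)))
    (v : X.V) :
    X.T1 p v ≤
      X.gInt p * X.aInt p * Real.exp (cV * c.M ^ c.d * c.R (D.flow.g (j + 1)) ^ (c.d + 1) * X.dZ p) *
        ((∏ i ∈ X.comps p,
            Real.exp (-(1 / 2) * c.γ₀ * (lam₀ * c.A₁) ^ 2 * p0Profile c.A₀ c.p₀ (D.flow.g (j + 1)) ^ 2 *
              (X.dC p i + 1) - 2 * p0Profile c.A₀ c.p₀ (D.flow.g (j + 1)))) *
          ∏ _i ∈ X.primed p, Real.exp (-p0Profile c.A₀ c.p₀ (D.flow.g j))) := by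
  have hlive := stepDisplaysAt_live h0 hγ hR μF μP hμF hμP hY hV hF hP hI
  have hγ' : 0 ≤ lam₀ ^ 2 * c.γ₀ := mul_nonneg (sq_nonneg _) hγ
  have hsmall' : 4 ≤ lam₀ ^ 2 * c.γ₀ * c.A₁ ^ 2 * p0Profile c.A₀ c.p₀ (D.flow.g (j + 1)) := by
    calc (4 : ℝ) ≤ c.γ₀ * (lam₀ * c.A₁) ^ 2 * p0Profile c.A₀ c.p₀ (D.flow.g (j + 1)) := hsmall
      _ = lam₀ ^ 2 * c.γ₀ * c.A₁ ^ 2 * p0Profile c.A₀ c.p₀ (D.flow.g (j + 1)) := by ring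
  have h := stepFactor179_le hlive (cV := cV) p hchain hB₃ hγ' hp hR2 hsmall' hround v
  refine h.trans (le_of_eq ?_)
  congr 2
  refine Finset.prod_congr rfl fun i _ => ?_
  congr 1
  ring

end Factor

/-! ## §4. The two live-letter hypotheses from print's provisos, below ONE `g⋆(λ₀)`; the closed form -/

/-- **THE LIVE ROUNDING CLAUSES HOLD «FOR g SUFFICIENTLY SMALL» DEPENDING ON `λ₀`.**  Fix `L ≥ 1` and (2.5)'s exponent
`r₀`, the profile exponents `p₀ ≥ 1`, `p₁` with the STRICT proviso of [B16] p. 383 «2p₁ − (d + 5)r₀ > p₀»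
(`Lit.B16Sect1Kernels.ExponentProviso383`), the amplitudes `A₀, A₁ > 0`, `γ₀ > 0`, and the slack `λ₀ > 0`.  THEN there
is ONE `g⋆ > 0` such that for every `0 < g ≦ g⋆`: (a) p. 381's clause at the live amplitude, `4 ≦ γ₀(λ₀A₁)²·p₀(g)`
(companion `clause_of_g_small`), and (b) p. 383's rounding read with the live factor, for every `R` by (2.5):
`exp(−R^{−d−5}(λ₀·p₁(g))²) ≦ exp(−p₀(g))` with print's AMPLITUDE-FREE `p₁(g) = (log g⁻²)^{p₁} = Lit.p0Profile 1 p₁ g`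
([B15] p. 183 l. 1 — the NE7b lineage's reading of the letter `P1`; companion `liveFactor383_of_g_small` at amplitude
`1` and `μ = λ₀`).  (Clauses (i)–(ii) of the companions' apex `LiveFactorJointClause.roadDelta_clauses_of_g_small` are
the same pair in the companions' normalisation `p₁(g) = A₁(log g⁻²)^{p₁}`, with the κ-induction's, the merger's and the
restriction-tail clauses below the same kind of `g⋆`.) [folklore] -/
theorem liveRounding_of_g_small {L r p₀ p₁ d : ℕ} {A₀ A₁ γ₀ lam₀ : ℝ} (hL : 1 ≤ L) (hp₀ : 1 ≤ p₀)
    (hprov : ExponentProviso383 p₀ p₁ r d) (hA₀ : 0 < A₀) (hA₁ : 0 < A₁) (hγ : 0 < γ₀) (h0 : 0 < lam₀) :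
    ∃ gstar : ℝ, 0 < gstar ∧ ∀ g : ℝ, 0 < g → g ≤ gstar →
      (4 ≤ γ₀ * (lam₀ * A₁) ^ 2 * p0Profile A₀ p₀ g) ∧
      (∀ R : ℕ, B14.IsRj L r g R →
        Real.exp (-((((R : ℝ) ^ (d + 5))⁻¹) * (lam₀ * p0Profile 1 p₁ g) ^ 2)) ≤
          Real.exp (-p0Profile A₀ p₀ g)) := by
  set g₁ : ℝ := Real.exp (-(max 1 (4 / (γ₀ * (lam₀ * A₁) ^ 2 * A₀)) / 2)) with hg₁def
  obtain ⟨g₂, hg₂, h₂⟩ := liveFactor383_of_g_small (p₀ := p₀) (p₁ := p₁) (r := r) (d := d) hL hA₀ one_pos h0 hprov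
  refine ⟨min g₁ g₂, lt_min (Real.exp_pos _) hg₂, fun g hg0 hg => ?_⟩
  obtain ⟨hle₁, hle₂⟩ := le_min_iff.1 hg
  exact ⟨clause_of_g_small (c := 4) hγ hA₀ hA₁.ne' h0 hp₀ hg0 (by rw [hg₁def] at hle₁; exact hle₁),
    fun R hR => h₂ g lam₀ R hg0 hle₂ hR le_rfl⟩

/-- **HEADLINE — (L1-step) FOR THE LARGE-FIELD FACTOR BLOCK, CLOSED FORM, IN THE NE7b LINEAGE's CURRENCY.**  Fix the
letters `c` with `A₀, A₁, γ₀ > 0`, `B₃ ≠ 0`, `p₀ ≥ 1`, the HOMOGENEOUS ledger relation `2B₃²A₁² ≦ A₀²`; the exponents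
`p₁`, `r₀` with the STRICT proviso of p. 383; `L ≥ 1`; the slack `λ₀ > 0`.  THEN there is ONE `g⋆ > 0` — «γ
sufficiently small» LAST — such that for every run `D`, every step `j` whose two couplings lie in `]0, g⋆]` and at
which the letters READ print's profiles (`R(g_j) = R_j` by (2.5), `Lit.B14.IsRj L r₀ g_j R_j`; `P1(g_j) = p₁(g_j) =
(log g_j⁻²)^{p₁} = Lit.p0Profile 1 p₁ g_j`, amplitude-free as in [B15] p. 183 and in the letter's docstring), every
carriers `X`, every choice `p` with p. 380's chain `hchain`, and every family of live
factors `μ, μ′ ≥ λ₀`: the LIVE step sentences (§2) imply (1.79)'s per-step factor at the amplitude `λ₀A₁` (§3) with NO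
residual «g small» hypothesis.  This is the `∀ c`-uniformity `Lit.T4ShellMeasureSocket.hybridNE7_tail_of_liveFactor`
asks of the single-run large-field bounds, for the block of [B16] pp. 380–383, stated ONCE in the structure node O's
step junction will instantiate.  CONDITIONAL on nothing but its displayed binders; nothing PRINTED is asserted;
INSTANCE of NE7c still 0∕1. [folklore] -/
theorem stepFactor179_live_of_g_small (c : B16StepFactorsPrinted.Consts) {L r p₁ : ℕ} {lam₀ : ℝ} (hL : 1 ≤ L)
    (hp₀ : 1 ≤ c.p₀)
    (hprov : ExponentProviso383 c.p₀ p₁ r c.d) (hA₀ : 0 < c.A₀) (hA₁ : 0 < c.A₁) (hγ : 0 < c.γ₀)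
    (hB₃ : c.B₃ ≠ 0) (hR2 : 2 * c.B₃ ^ 2 * c.A₁ ^ 2 ≤ c.A₀ ^ 2) (h0 : 0 < lam₀) :
    ∃ gstar : ℝ, 0 < gstar ∧
      ∀ (D : B16.RunData) (j : ℕ) (X : StepCarriers D j),
        0 < D.flow.g j → D.flow.g j ≤ gstar → 0 < D.flow.g (j + 1) → D.flow.g (j + 1) ≤ gstar →
        ∀ (Rj : ℕ), B14.IsRj L r (D.flow.g j) Rj → c.R (D.flow.g j) = Rj →
        c.P1 (D.flow.g j) = p0Profile 1 p₁ (D.flow.g j) →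
        ∀ (μF μP : X.Choice → X.ι → ℝ), (∀ p, ∀ i ∈ X.comps p, lam₀ ≤ μF p i) →
        (∀ p, ∀ i ∈ X.primed p, lam₀ ≤ μP p i) →
        (∀ p v, X.T1 p v ≤
          X.gInt p * X.aInt p * X.vfac p * (∏ i ∈ X.comps p, X.bfac p i) * ∏ i ∈ X.primed p, X.lfPrep p i) →
        (∀ p, 0 ≤ X.volZ p ∧
          X.vfac p ≤ Real.exp (c.C380 * Real.log ((D.flow.g (j + 1)) ^ 2)⁻¹ * X.volZ p)) →
        (∀ p, ∀ i ∈ X.comps p, 0 ≤ X.dC p i ∧ 0 ≤ X.bfac p i ∧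
          X.bfac p i ≤ Real.exp (-(c.γ₀ * minConst c.B₃ (μF p i * c.A₀) (μF p i * c.A₁) *
            p0Profile c.A₀ c.p₀ (D.flow.g (j + 1)) ^ 2 * (X.dC p i + 1)))) →
        (∀ p, ∀ i ∈ X.primed p, 0 ≤ X.lfPrep p i ∧
          X.lfPrep p i ≤
            Real.exp (-(c.R (D.flow.g j) ^ (c.d + 5))⁻¹ * (μP p i * c.P1 (D.flow.g j)) ^ 2)) →
        (∀ p, 0 ≤ X.gInt p ∧ X.gInt p ≤ 1 ∧ 0 ≤ X.aInt p ∧ X.aInt p ≤ Real.exp (c.C' * X.volZΩ p)) →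
        ∀ {cV : ℝ} (p : X.Choice),
          c.C380 * Real.log ((D.flow.g (j + 1)) ^ 2)⁻¹ * X.volZ p ≤
            cV * c.M ^ c.d * c.R (D.flow.g (j + 1)) ^ (c.d + 1) * X.dZ p →
          ∀ v : X.V,
            X.T1 p v ≤
              X.gInt p * X.aInt p * Real.exp (cV * c.M ^ c.d * c.R (D.flow.g (j + 1)) ^ (c.d + 1) * X.dZ p) *
                ((∏ i ∈ X.comps p,
                    Real.exp (-(1 / 2) * c.γ₀ * (lam₀ * c.A₁) ^ 2 * p0Profile c.A₀ c.p₀ (D.flow.g (j + 1)) ^ 2 *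
                      (X.dC p i + 1) - 2 * p0Profile c.A₀ c.p₀ (D.flow.g (j + 1)))) *
                  ∏ _i ∈ X.primed p, Real.exp (-p0Profile c.A₀ c.p₀ (D.flow.g j))) := by
  obtain ⟨gstar, hg, hcl⟩ := liveRounding_of_g_small (p₀ := c.p₀) (p₁ := p₁) (r := r) (d := c.d) hL hp₀ hprov
    hA₀ hA₁ hγ h0
  refine ⟨gstar, hg, fun D j X hgj0 hgj hgj'0 hgj' Rj hRj hRc hP1 μF μP hμF hμP hY hV hF hP hI cV p hchain v => ?_⟩
  -- the renewed level `j`: `0 ≤ R_j` and the rounding of p. 383 at `λ₀`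
  have hR0 : 0 ≤ c.R (D.flow.g j) := by rw [hRc]; exact Nat.cast_nonneg Rj
  have hround : Real.exp (-(c.R (D.flow.g j) ^ (c.d + 5))⁻¹ * (lam₀ * c.P1 (D.flow.g j)) ^ 2) ≤
      Real.exp (-p0Profile c.A₀ c.p₀ (D.flow.g j)) := by
    rw [hRc, hP1, neg_mul]
    exact (hcl (D.flow.g j) hgj0 hgj).2 Rj hRj
  -- the created level `j+1`: p. 381's clause at `λ₀A₁` and `0 ≤ p₀(g_{j+1})`
  have hsmall : 4 ≤ c.γ₀ * (lam₀ * c.A₁) ^ 2 * p0Profile c.A₀ c.p₀ (D.flow.g (j + 1)) :=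
    (hcl (D.flow.g (j + 1)) hgj'0 hgj').1
  have hp : 0 ≤ p0Profile c.A₀ c.p₀ (D.flow.g (j + 1)) := by
    have h4 : 0 < c.γ₀ * (lam₀ * c.A₁) ^ 2 := by positivity
    by_contra hneg
    have : c.γ₀ * (lam₀ * c.A₁) ^ 2 * p0Profile c.A₀ c.p₀ (D.flow.g (j + 1)) ≤ 0 :=
      mul_nonpos_of_nonneg_of_nonpos h4.le (not_le.mp hneg).le
    linarith
  exact stepFactor179_le_live h0.le hγ.le hR0 μF μP hμF hμP hY hV hF hP hI p hchain hB₃ hp hR2 hsmall hround v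

/-! ## §5. The printed-claim pattern: a construction with live steps satisfies `StepFactorsPrinted` at live letters -/

/-- **ROAD (δ)'s CONSTRUCTION INHABITS `StepFactorsPrinted` WITH THE LIVE LETTERS** (pattern `Lit.B16.Thm1Printed`).
If for a construction `C` with one-step carriers `X` there is `γ > 0` such that for every run in `]0, γ]` and every
step `j < K` the LIVE step sentences of §2 hold for SOME families of live factors `≥ λ₀` (member (δ-1) puts `λ` on the
youngest levels and `1` elsewhere — the run's own business), and `0 ≤ λ₀`, `0 ≤ γ₀`, `0 ≤ R(g)` for `g > 0`, THEN
`StepFactorsPrinted C X {c with γ₀ := λ₀²γ₀, P1 := λ₀·P1}` with the SAME `γ` — the NAME under which the NE7b lineage's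
pinned display cites print, now for the lowered-threshold run.  An implication between hypothesis shapes; which `C`,
`X` are Bałaban's is node O ∕ (A1c). [folklore] -/
theorem stepFactorsPrinted_live {C : B16.Construction} {X : (P : B12.RunParams) → (j : ℕ) → StepCarriers (C P) j}
    {c : B16StepFactorsPrinted.Consts} {lam₀ : ℝ} (h0 : 0 ≤ lam₀) (hγ : 0 ≤ c.γ₀)
    (hR : ∀ g : ℝ, 0 < g → 0 ≤ c.R g)
    (hlive : ∃ γ : ℝ, 0 < γ ∧ ∀ P : B12.RunParams, (C P).flow.InInterval γ P.K → ∀ j, j < P.K →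
      ∃ μF μP : (X P j).Choice → (X P j).ι → ℝ,
        (∀ p, ∀ i ∈ (X P j).comps p, lam₀ ≤ μF p i) ∧ (∀ p, ∀ i ∈ (X P j).primed p, lam₀ ≤ μP p i) ∧
        (∀ p v, (X P j).T1 p v ≤
          (X P j).gInt p * (X P j).aInt p * (X P j).vfac p * (∏ i ∈ (X P j).comps p, (X P j).bfac p i) *
            ∏ i ∈ (X P j).primed p, (X P j).lfPrep p i) ∧
        (∀ p, 0 ≤ (X P j).volZ p ∧
          (X P j).vfac p ≤ Real.exp (c.C380 * Real.log (((C P).flow.g (j + 1)) ^ 2)⁻¹ * (X P j).volZ p)) ∧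
        (∀ p, ∀ i ∈ (X P j).comps p, 0 ≤ (X P j).dC p i ∧ 0 ≤ (X P j).bfac p i ∧
          (X P j).bfac p i ≤ Real.exp (-(c.γ₀ * minConst c.B₃ (μF p i * c.A₀) (μF p i * c.A₁) *
            p0Profile c.A₀ c.p₀ ((C P).flow.g (j + 1)) ^ 2 * ((X P j).dC p i + 1)))) ∧
        (∀ p, ∀ i ∈ (X P j).primed p, 0 ≤ (X P j).lfPrep p i ∧
          (X P j).lfPrep p i ≤
            Real.exp (-(c.R ((C P).flow.g j) ^ (c.d + 5))⁻¹ * (μP p i * c.P1 ((C P).flow.g j)) ^ 2)) ∧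
        (∀ p, 0 ≤ (X P j).gInt p ∧ (X P j).gInt p ≤ 1 ∧ 0 ≤ (X P j).aInt p ∧
          (X P j).aInt p ≤ Real.exp (c.C' * (X P j).volZΩ p))) :
    StepFactorsPrinted C X { c with γ₀ := lam₀ ^ 2 * c.γ₀, P1 := fun g => lam₀ * c.P1 g } := by
  obtain ⟨γ, hγ0, hall⟩ := hlive
  refine ⟨γ, hγ0, fun P hP j hj => ?_⟩
  obtain ⟨μF, μP, hμF, hμP, hY, hV, hF, hPf, hI⟩ := hall P hP j hj
  have hgj : 0 < (C P).flow.g j := (hP j hj.le).1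
  exact stepDisplaysAt_live h0 hγ (hR _ hgj) μF μP hμF hμP hY hV hF hPf hI

/-! ## §6. Sanity (shape non-vacuity; honest scope) -/

/-- SANITY (shape non-vacuity only; says NOTHING about Bałaban's objects): the trivial one-step carriers of p344269's
§4 — one choice, no component, unit weight and integrals `≡ 1`, `|Z| = 0` — satisfy the LIVE sentences for any live
factors, hence `StepDisplaysAt` at the live letters for any `λ₀ ≥ 0` (letters with `γ₀, R ≥ 0`). [folklore] -/
example (D : B16.RunData) (j : ℕ) (c : B16StepFactorsPrinted.Consts) (hγ : 0 ≤ c.γ₀)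
    (hR : 0 ≤ c.R (D.flow.g j)) {lam₀ : ℝ} (h0 : 0 ≤ lam₀) :
    StepDisplaysAt D j
      { Choice := Unit, V := Unit, ι := Unit, T1 := fun _ _ => 1, comps := fun _ => ∅, primed := fun _ => ∅,
        dC := fun _ _ => 0, bfac := fun _ _ => 0, lfPrep := fun _ _ => 0, vfac := fun _ => 1, volZ := fun _ => 0,
        dZ := fun _ => 0, gInt := fun _ => 1, aInt := fun _ => 1, volZΩ := fun _ => 0 }
      { c with γ₀ := lam₀ ^ 2 * c.γ₀, P1 := fun g => lam₀ * c.P1 g } :=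
  stepDisplaysAt_live h0 hγ hR (fun _ _ => lam₀) (fun _ _ => lam₀) (fun _ _ _ => le_rfl) (fun _ _ _ => le_rfl)
    (fun _ _ => by simp) (fun _ => by simp) (fun _ i hi => by simp at hi) (fun _ i hi => by simp at hi)
    (fun _ => by simp)

end

end Summit.QuantumFields.BalabanUV.T4Continuum.Spine.NE7c.LiveFactorStepFactors
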